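import Summits.BirchSwinnertonDyer.BirchSwinnertonDyer.Theorems.CongruentShaFreeCutTwoAdicLinks
import Summits.BirchSwinnertonDyer.Rank1Residual.X11b.BDPRouteControlTorsion
import Summits.BirchSwinnertonDyer.Rank1Residual.X11b.AnticyclotomicEulerChar
import Summits.BirchSwinnertonDyer.Rank1Residual.Partition.AnticyclotomicControlPublished

/-! # Route `CongruentShaFreeCut` (rung S2) — crux `AnalyticRankOneOfRankOneFiniteShaTwo`
(stmt-BirchSwinnertonDyer-19080): Link A `TwoAdicControlOfRankOne` REDUCES, in the kernel, to the
finiteness of Castella's Selmer group of `E_n` OVER `K` — `Sel_{v̄}^{∅}(K, E_n[2^∞])` (strict at `v̄`,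
relaxed at `v`, trivial off `2`)

Cell `bsd-cn100`, prover seat `bsd-cn100-s2-c3` g3. Supports, does not close, stmt-BirchSwinnertonDyer-19080
(registered stub `stub_twoAdicControlOfRankOne : TwoAdicControlOfRankOne`, skeleton `two-adic-links`).
HONEST FRAMING: nothing here proves crux B, the leaf `rankOne_twoConverse_congruentNumber` or any case
of BSD; Link A itself is NOT proved here — it is reduced to ONE finiteness statement about a Selmer
group over the base field `K` (the written proof's Steps 1–4, MEMO-LinkA, HOME/bsd-cn100-s2-c3/), the
tower part of the written proof (Steps 5–7: local kernels, control, Nakayama/Greenberg) being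
DISCHARGED by kernel theorems of the b2b cell's sub-tree `Summits/BirchSwinnertonDyer/Rank1Residual/X11b`
(Castella's construction, on which the Literature object `Castella2018.AcSelmer.XAc` of Link A is
modelled term for term: `X11b.AcSelmer.hasCharValuationAt_iff_literature` is `Iff.rfl`).

## What is proved

* `finite_endInvariants_of_finite_selmerAcBase` — for ANY elliptic, globally minimal `W/ℚ`, ANY prime
  `p`, an imaginary quadratic `K` in which `p` splits, an anticyclotomic `ℤ_p`-extension `κ` with
  topological generator `γ` and a prime `𝔭 ∋ p` of `K`: if Castella's Selmer group over `K`,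
  `Sel_𝔭(K, E[p^∞]) = X11b.AcSelmer.selmerAcBase (W_K) p 𝔭 ∅`, is finite, then the `Γ`-invariants
  `Sel_𝔭(K_∞, E[p^∞])^γ` of Castella's Selmer group over the tower are finite. Assembly of the X11b
  kernel theorems: the counting snake lemma with the strict place among the counted kernels
  (`finite_endInvariants_and_natCard_le_of_localKer_strict`, NO torsion hypothesis at `𝔭` — the point
  for `E_n` at `2`, where `E_n[2] ⊂ E_n(ℚ)`), Greenberg's Lemma 3.3 at every place
  (`natCard_localKer_le_natCard_primaryComponent_padic` at `𝔭`,
  `natCard_localKer_le_pow_padicValNat_localTamagawaNumber` at the bad `v ∤ p`), and the away descent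
  at the good / inert / ramified places (`away_descent_of_splitBad_subset`). No reduction-type
  hypothesis at `p`: valid at the ADDITIVE prime `2` of `E_n`.
* `hasCharValuationAt_of_finite_selmerAcBase` — under the same hypotheses `X_ac(E[p^∞])` is
  `Λ`-torsion with a characteristic generator `f`, `f(0) ≠ 0`, i.e. `∃ m, HasCharValuationAt … m` ON
  THE LITERATURE OBJECT (`X11b.AcSelmer.XAc.exists_hasCharValuationAt_of_finite` = Greenberg's
  criterion, through the defeq bridge).
* `twoAdicControlOfRankOne_of_finite_selmerAcBase` — **Link A ⟸ «for square-free `n` and the data of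
  Link A, `rank E_n(K) = 1 ∧ #Ш(E_n/K)[2^∞] < ∞ ⟹ Sel_{v̄}(K, E_n[2^∞])` is finite»** (hypothesis
  stated inline, token-compatible with Link A's binders; no new definition).

So the residue of Link A in tree currency is now a statement about ONE Selmer group over the base
field (JSW17 Prop. 3.2.1 `≤` / Cas18 (3.2.1): Poitou–Tate + the local Euler characteristic + the
rank-one Kummer image), not about the `ℤ₂`-tower. [cite: GreenbergLNM1716, §3 Lemma 3.2, Lemma 3.3, p. 90; §4 Lemma 4.2]
[cite: JetchevSkinnerWan2017, §3.3 (proof of Thm. 3.3.1) and §3.3.5] [cite: Castella2018, Def. 2.2, Thm. 2.3 (arXiv:1704.06608 p. 5)] -/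

noncomputable section

open scoped Classical

namespace Summit.BirchSwinnertonDyer.BirchSwinnertonDyer.Theorems.CongruentShaFreeCutTwoAdicControlOfSelmerFinite

open WeierstrassCurve NumberField IsDedekindDomain Field Literature.NumberTheory.EllipticCurves
open Literature.NumberTheory.EllipticCurves.GreenbergSelmer
open Summit.BirchSwinnertonDyer.Rank1Residual.X11b
open Summit.BirchSwinnertonDyer.Rank1Residual.X11b.AcSelmer

/-! ## 1. `Sel_𝔭(K, E[p^∞])` finite ⟹ `Sel_𝔭(K_∞, E[p^∞])^γ` finite (any reduction type at `p`) -/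

/-- **Control, finiteness form, at an anticyclotomic datum with NO hypothesis at the strict place.**
For an elliptic, globally minimal `W/ℚ`, a prime `p`, an imaginary quadratic field `K` in which `p`
splits, an anticyclotomic `ℤ_p`-extension `κ` of `K` with topological generator `γ`, and a prime
`𝔭 ∋ p` of `K`: if Castella's Selmer group `Sel_𝔭(K, E[p^∞])` (strict at `𝔭`, relaxed at `𝔭̄`,
trivial off `p`) is finite, then so is `Sel_𝔭(K_∞, E[p^∞])^γ = ker(conj_γ − 1)`. Proof: the X11b
counting snake lemma over `T = {𝔭} ∪ Σ(N⁺)` (`finite_endInvariants_and_natCard_le_of_localKer_strict`):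
`res : A ↠ Sel^γ` (Greenberg Lemma 3.2), the localisation of `A` has kernel `Sel_𝔭(K, E[p^∞])` and
image in `∏_{v ∈ T} ker r_v`, each finite by Greenberg's Lemma 3.3 (`#ker r_𝔭 ≤ #E(ℚ_p)[p^∞]`,
`#ker r_v ≤ c_v^{(p)}`), the away conditions descending off `T`. No hypothesis on `E(K_𝔭)[p]` or on
the reduction of `W` at `p`. [cite: GreenbergLNM1716, §3 Lemma 3.2, Lemma 3.3 (p. 87), p. 90]
[cite: JetchevSkinnerWan2017, §3.3 (proof of Thm. 3.3.1; shape)] -/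
theorem finite_endInvariants_of_finite_selmerAcBase (W : WeierstrassCurve ℚ) [W.IsElliptic]
    [W.IsGloballyMinimal] (p : ℕ) [Fact p.Prime] {K : Type} [Field K] [NumberField K]
    (hK : IsImaginaryQuadratic K) (hsplit : SplitsIn K p) (κ : ZpExtension K p)
    (hκ : κ.IsAnticyclotomic) (γ : absoluteGaloisGroup K) [hγ : Fact (κ.IsTopGenerator γ)]
    (𝔭 : HeightOneSpectrum (𝓞 K)) (h𝔭 : ((p : ℕ) : 𝓞 K) ∈ 𝔭.asIdeal)
    [Finite (selmerAcBase (W.baseChange K) p 𝔭 ∅)] :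
    Finite (IwasawaDual.endInvariants (conjSelmerAc (W.baseChange K) p κ 𝔭 ∅ γ - 1)) := by
  haveI hEK : (W.baseChange K).IsElliptic := by rw [baseChange]; infer_instance
  haveI : IsTotallyComplex K := hK.isTotallyComplex
  have h2 : Module.finrank ℚ K = 2 := hK.1
  obtain ⟨he, hf⟩ := degreeOne_of_splitsIn h2 hsplit h𝔭
  -- the finite set `T = Σ(N⁺) ∪ {𝔭}`
  have hSp : ∀ v ∈ (nPlusPlaces_finite (W := W) (K := K) (p := p) h2).toFinset,
      ((p : ℕ) : 𝓞 K) ∉ v.asIdeal := fun v hv ↦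
    (((nPlusPlaces_finite (W := W) (K := K) (p := p) h2).mem_toFinset).mp hv).1
  -- the local kernel at the strict place is finite (`#ker r_𝔭 ≤ #E(ℚ_p)[p^∞]`)
  obtain ⟨hfin𝔭, -⟩ := natCard_localKer_le_natCard_primaryComponent_padic W p κ 𝔭 h𝔭 he hf
  exact (finite_endInvariants_and_natCard_le_of_localKer_strict (W := W.baseChange K) (S := ∅)
    hγ.out (insert 𝔭 (nPlusPlaces_finite (W := W) (K := K) (p := p) h2).toFinset)
    (Finset.mem_insert_self 𝔭 _)
    (fun v hv hv𝔭 ↦ hSp v ((Finset.mem_insert.mp hv).resolve_left hv𝔭))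
    (fun v _ ↦ Set.notMem_empty v)
    (fun c hc v hv _ hvT ↦ away_descent_of_splitBad_subset (W.baseChange K) p κ 𝔭
      (↑(insert 𝔭 (nPlusPlaces_finite (W := W) (K := K) (p := p) h2).toFinset) :
        Set (HeightOneSpectrum (𝓞 K))) h2 hκ
      (fun v' hpv hbad he' hf' ↦ Finset.mem_coe.mpr (Finset.mem_insert_of_mem
        (((nPlusPlaces_finite (W := W) (K := K) (p := p) h2).mem_toFinset).mpr
          (mem_nPlusPlaces_of v' hpv
            (primesEquiv_under_dvd_conductorNorm_of_not_hasGoodReductionAt K v' hbad) he' hf'))))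
      c (selmerAc_empty_le hc) v hv (fun h ↦ hvT (Finset.mem_coe.mp h)))
    (fun v hv ↦ by
      rcases Finset.mem_insert.mp hv with rfl | hvS
      · exact hfin𝔭
      · exact (natCard_localKer_le_pow_padicValNat_localTamagawaNumber (W.baseChange K) κ
          (hSp v hvS)).1)).1

/-- **`Sel_𝔭(K, E[p^∞])` finite ⟹ `X_ac(E[p^∞])` is `Λ`-torsion with `f(0) ≠ 0`**, stated on the
LITERATURE object `Castella2018.AcSelmer.XAc` (`∃ m, HasCharValuationAt … m`): Greenberg's criterion
(`X11b.AcSelmer.XAc.exists_hasCharValuationAt_of_finite`: `Sel^γ` finite ⟹ finitely generated,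
torsion, principal characteristic ideal with `f(0) ≠ 0`) after
`finite_endInvariants_of_finite_selmerAcBase`, transported by the defeq bridge
`X11b.AcSelmer.hasCharValuationAt_iff_literature`. [cite: GreenbergLNM1716, §1 p. 60 and §4 Lemma 4.2]
[cite: Castella2018, Def. 2.2 and Thm. 2.3 (arXiv:1704.06608 p. 5) (shape)] -/
theorem hasCharValuationAt_of_finite_selmerAcBase (W : WeierstrassCurve ℚ) [W.IsElliptic]
    [W.IsGloballyMinimal] (p : ℕ) [Fact p.Prime] {K : Type} [Field K] [NumberField K]
    (hK : IsImaginaryQuadratic K) (hsplit : SplitsIn K p) (κ : ZpExtension K p)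
    (hκ : κ.IsAnticyclotomic) (γ : absoluteGaloisGroup K) [Fact (κ.IsTopGenerator γ)]
    (𝔭 : HeightOneSpectrum (𝓞 K)) (h𝔭 : ((p : ℕ) : 𝓞 K) ∈ 𝔭.asIdeal)
    [Finite (selmerAcBase (W.baseChange K) p 𝔭 ∅)] :
    ∃ m : ℕ, Castella2018.AcSelmer.XAc.HasCharValuationAt (W.baseChange K) p κ 𝔭 ∅ γ m := by
  obtain ⟨m, hm⟩ := XAc.exists_hasCharValuationAt_of_finite (W.baseChange K) p κ 𝔭 ∅ γ
    (finite_endInvariants_of_finite_selmerAcBase W p hK hsplit κ hκ γ 𝔭 h𝔭)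
  exact ⟨m, (AcSelmer.hasCharValuationAt_iff_literature (W.baseChange K) p κ 𝔭 ∅ γ m).mp hm⟩

/-! ## 2. Link A from the finiteness of `Sel_{v̄}(K, E_n[2^∞])` -/

/-- **Link A `TwoAdicControlOfRankOne` REDUCES to the finiteness of Castella's Selmer group of `E_n`
over the base field `K`.** If, at every datum of Link A — square-free `n`, `K` imaginary quadratic
with the Heegner hypothesis for `N = N(E_n)` and for `2`, `ι : K ↪ ℚ₂` inducing `v`, `v̄ ∋ 2`, `v̄ ≠ v`,
`rank E_n(K) = 1`, `#Ш(E_n/K)[2^∞] < ∞` — the group `Sel_{v̄}(K, E_n[2^∞])` (classes of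
`H¹(K, E_n[2^∞])` strict at `v̄`, unconstrained at `v`, trivial off `2`;
`X11b.AcSelmer.selmerAcBase ((E_n)_K) 2 v̄ ∅`) is FINITE, then Link A holds: the `2`-adic tower part
(local kernels incl. the strict place where `E_n[2] ≠ 0`, control, Nakayama, Greenberg's criterion)
is `hasCharValuationAt_of_finite_selmerAcBase` at `p = 2` (the Heegner hypothesis for `2` says `2`
splits in `K`). The hypothesis is the written proof's Steps 1–4 (Poitou–Tate twice with the rank-one
Kummer image; MEMO-LinkA), stated inline; nothing asserted. [cite: GreenbergLNM1716, §3 Lemma 3.3, p. 90; §4 Lemma 4.2]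
[cite: JetchevSkinnerWan2017, Prop. 3.2.1 and §3.3 (shape)] [cite: Castella2018, Def. 2.2, Thm. 2.3 (arXiv:1704.06608 p. 5) (shape)] -/
theorem twoAdicControlOfRankOne_of_finite_selmerAcBase
    (hSel : ∀ ⦃n : ℕ⦄, Squarefree n → ∀ (K : Type) [Field K] [NumberField K] (N : ℕ) [NeZero N],
      (congruentNumberCurve n).conductorNorm ℤ = N → IsImaginaryQuadratic K →
        SatisfiesHeegnerHypothesis N K → SatisfiesHeegnerHypothesis 2 K →
      ∀ (ι : K →+* ℚ_[2]) (v vbar : HeightOneSpectrum (𝓞 K)),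
        (∀ x : 𝓞 K, x ∈ v.asIdeal ↔ ‖ι (x : K)‖ < 1) →
        ((2 : ℕ) : 𝓞 K) ∈ vbar.asIdeal → vbar ≠ v →
        ((congruentNumberCurve n).baseChange K).mordellWeilRank = 1 →
        Finite (AddCommGroup.primaryComponent ((congruentNumberCurve n).baseChange K).sha 2) →
        Finite (selmerAcBase ((congruentNumberCurve n).baseChange K) 2 vbar ∅)) :
    CongruentShaFreeCutTwoAdicLinks.TwoAdicControlOfRankOne := by
  intro n hn K _ _ N _ hN hK hHN hH2 ι v vbar hv hvbar hne κ hκ γ _ hrank hsha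
  haveI := isElliptic_congruentNumberCurve hn.ne_zero
  haveI := isGloballyMinimal_congruentNumberCurve hn
  haveI : Finite (selmerAcBase ((congruentNumberCurve n).baseChange K) 2 vbar ∅) :=
    hSel hn K N hN hK hHN hH2 ι v vbar hv hvbar hne hrank hsha
  have hsplit : SplitsIn K 2 := hH2 2 Fact.out (dvd_refl 2)
  exact hasCharValuationAt_of_finite_selmerAcBase (congruentNumberCurve n) 2 hK hsplit κ hκ γ vbar
    hvbar

end Summit.BirchSwinnertonDyer.BirchSwinnertonDyer.Theorems.CongruentShaFreeCutTwoAdicControlOfSelmerFinite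

end
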